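import Mathlib
import HarnessLib

/-!
# Periodic summation by parts: decay of twisted grid sums on the discrete circle

Topic `Literature/MathematicalPhysics/QuantumLattice` (family `hubbard`).  The elementary
one-dimensional toolkit behind the decay of TRANSLATION-INVARIANT torus resolvents
`G(x − y) = L^{-d} Σ_k e^{ik·(x−y)} Ŝ(k)` across a cut: in one momentum direction the lattice sum is a
twisted grid sum `Σ_{j<L} ω^j g(2πj/L)` of a smooth `2π`-periodic slice `g` of the symbol against a
nontrivial `L`-th root of unity `ω = e^{2πi n/L}`, and summation by parts trades powers of the torus
distance `d = min(n, L − n)` for derivatives of `g`.  Fully proved, no definition is introduced: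

* `one_sub_inv_mul_sum_pow_mul` — **periodic summation by parts** on `ℤ/Lℤ`:
  `(1 − ω⁻¹) Σ_{j<L} ω^j f(j) = Σ_{j<L} ω^j (f(j) − f(j+1))` for `ω^L = 1`, `f(L) = f(0)`;
* `zmod_norm_one_sub_exp_ge` — **`|1 − ω| ≥ 4d/L`** (`|1 − e^{iθ}| = 2|sin(θ/2)|` and Jordan's
  inequality `sin x ≥ 2x/π` on `[0, π/2]`, Mathlib `Real.mul_le_sin`), `inv_norm_one_sub_exp_le`,
  `exp_two_pi_natCast_div_pow_eq_one`, `norm_one_sub_inv_of_norm_eq_one`;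
* `sum_norm_sub_le_integral_norm_deriv` — **first differences under `∫‖g'‖`**:
  `Σ_{j<n} ‖F(u + (j+1)T/n) − F(u + jT/n)‖ ≤ ∫₀ᵀ ‖F'‖` for a `C¹` `T`-periodic `F` (fundamental
  theorem of calculus on each cell; `periodic_deriv`);
* `norm_sum_pow_mul_sample_le` — `‖Σ_{j<n} ω^j F(u + jT/n)‖ ≤ |1 − ω|⁻¹ ∫₀ᵀ ‖F'‖`;
* `norm_sum_rootOfUnity_pow_mul_grid_le(_two)` — the **first- and second-order decay bounds**
  `‖Σ_{j<L} ω^j g(2πj/L)‖ ≤ (L/4d) ∫₀^{2π}‖g'‖` and `≤ (2π/L)(L/4d)² ∫₀^{2π}‖g''‖` (the second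
  summation by parts is performed inside the integral `g(jh) − g(jh+h) = −∫₀ʰ g'(jh + v) dv`);
* `norm_twisted_double_grid_sum_le` — the packaged two-dimensional statement used by torus
  resolvent estimates: `‖L⁻² Σ_{j₁j₂} ω^{j₁} c_{j₂} F(2πj₁/L, 2πj₂/L)‖ ≤ Φ₁/(4d)` and
  `≤ (π/4)Φ₂/d²`, `Φ_m = L⁻¹ Σ_{j₂} ∫₀^{2π} ‖∂₁^m F(·, 2πj₂/L)‖`, `‖c_j‖ ≤ 1`.

## Mathlib / tree search

REUSED (Mathlib): `Complex.norm_exp_I_mul_ofReal_sub_one`, `Real.mul_le_sin`,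
`intervalIntegral.integral_deriv_eq_sub`, `intervalIntegral.norm_integral_le_integral_norm`,
`intervalIntegral.sum_integral_adjacent_intervals`, `Function.Periodic.intervalIntegral_add_eq`,
`intervalIntegral.norm_integral_le_of_norm_le_const`, `intervalIntegral.integral_finsetSum`,
`Fin.sum_univ_eq_sum_range`.  `lean search 'summation by parts|Abel summation'`: Mathlib has
`Finset.sum_Ico_by_parts` (non-periodic Abel summation, with boundary terms) — the periodic,
boundary-free form needed here is three lines, proved directly.  The tree has several
`periodic_deriv` variants in unrelated namespaces (`Literature/Analysis/FluidPDE/…`,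
`Literature/Topology/…`); restated here in three lines to keep the imports minimal.

## References

Standard material: Abel/partial summation and the decay of Fourier coefficients of smooth periodic
functions (A. Zygmund, *Trigonometric Series*, Vol. I, Ch. I §2 and Ch. II §4); Fourier analysis on
the discrete torus as used for lattice propagators (S. Friedli, Y. Velenik, *Statistical Mechanics
of Lattice Systems*, CUP 2017, §10.4 and App. B).
-/

noncomputable section

namespace Literature.MathematicalPhysics.QuantumLattice

open Finset MeasureTheory intervalIntegral
open scoped Real

/-! ### Periodic summation by parts -/

/-- **Periodic summation by parts** on `ℤ/nℤ`: if `ω ^ n = 1`, `ω ≠ 0` and `f n = f 0`, then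
`(1 − ω⁻¹) Σ_{j<n} ω^j f(j) = Σ_{j<n} ω^j (f(j) − f(j+1))`. [folklore] -/
theorem one_sub_inv_mul_sum_pow_mul (n : ℕ) {ω : ℂ} (hω : ω ^ n = 1) (hω0 : ω ≠ 0) (f : ℕ → ℂ)
    (hf : f n = f 0) :
    (1 - ω⁻¹) * ∑ j ∈ range n, ω ^ j * f j = ∑ j ∈ range n, ω ^ j * (f j - f (j + 1)) := by
  have h1 : ∑ j ∈ range (n + 1), ω ^ j * f j = f 0 + ∑ j ∈ range n, ω ^ (j + 1) * f (j + 1) := by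
    rw [Finset.sum_range_succ', pow_zero, one_mul, add_comm]
  have h2 : ∑ j ∈ range (n + 1), ω ^ j * f j = ∑ j ∈ range n, ω ^ j * f j + ω ^ n * f n :=
    Finset.sum_range_succ _ _
  rw [hω, hf, one_mul] at h2
  have h3 : ∑ j ∈ range n, ω ^ j * f (j + 1) = ω⁻¹ * ∑ j ∈ range n, ω ^ (j + 1) * f (j + 1) := by
    rw [Finset.mul_sum]
    refine sum_congr rfl fun j _ => ?_
    rw [pow_succ]
    field_simp
  have h4 : ∑ j ∈ range n, ω ^ j * f (j + 1) = ω⁻¹ * ∑ j ∈ range n, ω ^ j * f j := by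
    rw [h3]
    congr 1
    linear_combination h2 - h1
  rw [sub_mul, one_mul, ← h4, ← Finset.sum_sub_distrib]
  exact sum_congr rfl fun j _ => by ring

/-- For `‖ω‖ = 1`: `‖1 − ω⁻¹‖ = ‖1 − ω‖`. [folklore] -/
theorem norm_one_sub_inv_of_norm_eq_one {ω : ℂ} (hω : ‖ω‖ = 1) : ‖1 - ω⁻¹‖ = ‖1 - ω‖ := by
  have hω0 : ω ≠ 0 := fun h => by simp [h] at hω
  have : 1 - ω⁻¹ = -(ω⁻¹ * (1 - ω)) := by field_simp; ring
  rw [this, norm_neg, norm_mul, norm_inv, hω, inv_one, one_mul]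

/-- **Distance of a nontrivial `L`-th root of unity from `1`**: for `n ∈ ℤ/Lℤ`, `n ≠ 0`, with torus
distance `d = min(n.val, L − n.val)` to `0`, `‖1 − e^{2πi n/L}‖ = 2 sin(π d/L) ≥ 4d/L` (Jordan's
inequality). [folklore] -/
theorem zmod_norm_one_sub_exp_ge {L : ℕ} [NeZero L] (n : ZMod L) (hn : n ≠ 0) :
    4 * ((min n.val (-n).val : ℕ) : ℝ) / L ≤
      ‖1 - Complex.exp (2 * π * Complex.I * (n.val : ℕ) / L)‖ := by
  have hL : (0 : ℝ) < L := Nat.cast_pos.mpr (Nat.pos_of_ne_zero (NeZero.ne L))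
  have hvL : n.val < L := ZMod.val_lt n
  have hv0 : 0 < n.val := Nat.pos_of_ne_zero ((ZMod.val_ne_zero n).mpr hn)
  rw [ZMod.neg_val, if_neg hn]
  set m := n.val with hm
  set d := min m (L - m) with hd
  have hdle : 2 * d ≤ L := by omega
  have hsin : Real.sin (π * m / L) = Real.sin (π * d / L) := by
    rcases le_total m (L - m) with h | h
    · rw [hd, min_eq_left h]
    · rw [hd, min_eq_right h, Nat.cast_sub hvL.le]
      rw [show π * ((L : ℝ) - m) / L = π - π * m / L by
        rw [eq_sub_iff_add_eq, ← add_div, ← mul_add, sub_add_cancel, mul_div_assoc,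
          div_self hL.ne', mul_one], Real.sin_pi_sub]
  have harg : 2 * π * Complex.I * (m : ℕ) / L = Complex.I * ((2 * π * m / L : ℝ) : ℂ) := by
    push_cast; ring
  rw [norm_sub_rev, harg, Complex.norm_exp_I_mul_ofReal_sub_one,
    show 2 * π * (m : ℝ) / L / 2 = π * m / L by ring, hsin]
  have hx0 : 0 ≤ π * d / L := by positivity
  have hx1 : π * d / L ≤ π / 2 := by
    rw [div_le_div_iff₀ hL two_pos]
    have : (2 : ℝ) * d ≤ L := by exact_mod_cast hdle
    nlinarith [Real.pi_pos]
  have hj := Real.mul_le_sin hx0 hx1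
  have hsin0 : 0 ≤ Real.sin (π * d / L) := Real.sin_nonneg_of_nonneg_of_le_pi hx0 (by linarith)
  rw [Real.norm_eq_abs, abs_of_nonneg (by linarith)]
  calc 4 * (d : ℝ) / L = 2 * (2 / π * (π * d / L)) := by field_simp; ring
    _ ≤ 2 * Real.sin (π * d / L) := by linarith

/-- `e^{2πi n/L}` is an `L`-th root of unity of norm one. [folklore] -/
theorem exp_two_pi_natCast_div_pow_eq_one {L : ℕ} [NeZero L] (m : ℕ) :
    Complex.exp (2 * π * Complex.I * (m : ℕ) / L) ^ L = 1 ∧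
      ‖Complex.exp (2 * π * Complex.I * (m : ℕ) / L)‖ = 1 := by
  have hL : (L : ℂ) ≠ 0 := Nat.cast_ne_zero.mpr (NeZero.ne L)
  constructor
  · rw [← Complex.exp_nat_mul,
      show (L : ℂ) * (2 * π * Complex.I * (m : ℕ) / L) = m * (2 * π * Complex.I) by field_simp]
    exact Complex.exp_nat_mul_two_pi_mul_I m
  · rw [show 2 * π * Complex.I * (m : ℕ) / L = ((2 * π * m / L : ℝ) : ℂ) * Complex.I by
      push_cast; ring]
    exact Complex.norm_exp_ofReal_mul_I _

/-! ### Differences along a grid are controlled by the derivative -/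

/-- The derivative of a periodic function is periodic. [folklore] -/
theorem periodic_deriv {F : ℝ → ℂ} {T : ℝ} (hper : Function.Periodic F T) :
    Function.Periodic (deriv F) T := fun x => by
  have h : (fun y => F (y + T)) = F := funext hper
  rw [← deriv_comp_add_const, h]

/-- **Telescoping differences under the integral of `‖F'‖`**: for a `C¹` `T`-periodic `F` and the
grid `u + jT/n`, `Σ_{j<n} ‖F(u + (j+1)T/n) − F(u + jT/n)‖ ≤ ∫₀ᵀ ‖F'‖`. [folklore] -/
theorem sum_norm_sub_le_integral_norm_deriv {F : ℝ → ℂ} {T : ℝ} (hT : 0 < T) (hF : ContDiff ℝ 1 F)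
    (hper : Function.Periodic F T) {n : ℕ} (hn : 0 < n) (u : ℝ) :
    ∑ j ∈ range n, ‖F (u + (j + 1 : ℕ) * (T / n)) - F (u + j * (T / n))‖ ≤
      ∫ x in (0 : ℝ)..T, ‖deriv F x‖ := by
  have hdiff : Differentiable ℝ F := hF.differentiable one_ne_zero
  have hcont : Continuous (deriv F) := hF.continuous_deriv le_rfl
  have hh : 0 ≤ T / n := by positivity
  set a : ℕ → ℝ := fun j => u + j * (T / n) with ha
  have hmono : ∀ j : ℕ, a j ≤ a (j + 1) := fun j => by
    simp only [ha]; push_cast; nlinarith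
  have hterm : ∀ j : ℕ, ‖F (a (j + 1)) - F (a j)‖ ≤ ∫ x in a j..a (j + 1), ‖deriv F x‖ := by
    intro j
    rw [← intervalIntegral.integral_deriv_eq_sub (fun x _ => hdiff x)
      (hcont.intervalIntegrable _ _)]
    exact intervalIntegral.norm_integral_le_integral_norm (hmono j)
  calc ∑ j ∈ range n, ‖F (u + (j + 1 : ℕ) * (T / n)) - F (u + j * (T / n))‖
      = ∑ j ∈ range n, ‖F (a (j + 1)) - F (a j)‖ := by simp only [ha]
    _ ≤ ∑ j ∈ range n, ∫ x in a j..a (j + 1), ‖deriv F x‖ := sum_le_sum fun j _ => hterm j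
    _ = ∫ x in a 0..a n, ‖deriv F x‖ :=
        intervalIntegral.sum_integral_adjacent_intervals fun k _ =>
          (hcont.norm.intervalIntegrable _ _)
    _ = ∫ x in (0 : ℝ)..T, ‖deriv F x‖ := by
        have h0 : a 0 = u := by simp [ha]
        have hn' : a n = u + T := by
          simp only [ha]; rw [mul_div_cancel₀]; exact Nat.cast_ne_zero.mpr hn.ne'
        have hp : Function.Periodic (fun x => ‖deriv F x‖) T := (periodic_deriv hper).comp _
        rw [h0, hn', hp.intervalIntegral_add_eq u 0, zero_add]

/-- **Sample sums against a nontrivial root of unity**: for a `C¹` `T`-periodic `F`, `ω ^ n = 1`,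
`‖ω‖ = 1`, `ω ≠ 1`: `‖Σ_{j<n} ω^j F(u + jT/n)‖ ≤ ‖1 − ω‖⁻¹ ∫₀ᵀ ‖F'‖` (summation by parts and the
telescoping bound). [folklore] -/
theorem norm_sum_pow_mul_sample_le {F : ℝ → ℂ} {T : ℝ} (hT : 0 < T) (hF : ContDiff ℝ 1 F)
    (hper : Function.Periodic F T) {n : ℕ} (hn : 0 < n) {ω : ℂ} (hωn : ω ^ n = 1) (hω1 : ‖ω‖ = 1)
    (hne : ω ≠ 1) (u : ℝ) :
    ‖∑ j ∈ range n, ω ^ j * F (u + j * (T / n))‖ ≤ ‖1 - ω‖⁻¹ * ∫ x in (0 : ℝ)..T, ‖deriv F x‖ := by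
  have hω0 : ω ≠ 0 := fun h => by simp [h] at hω1
  have hpos : 0 < ‖1 - ω‖ := norm_pos_iff.mpr (sub_ne_zero.mpr (Ne.symm hne))
  set f : ℕ → ℂ := fun j => F (u + j * (T / n)) with hf
  have hfn : f n = f 0 := by
    simp only [hf, Nat.cast_zero, zero_mul, add_zero]
    rw [mul_div_cancel₀ _ (Nat.cast_ne_zero.mpr hn.ne' : (n : ℝ) ≠ 0)]
    exact hper u
  have hsbp := one_sub_inv_mul_sum_pow_mul n hωn hω0 f hfn
  have hbound : ‖(1 - ω⁻¹) * ∑ j ∈ range n, ω ^ j * f j‖ ≤ ∫ x in (0 : ℝ)..T, ‖deriv F x‖ := by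
    rw [hsbp]
    refine (norm_sum_le _ _).trans ?_
    refine le_trans ?_ (sum_norm_sub_le_integral_norm_deriv hT hF hper hn u)
    refine sum_le_sum fun j _ => ?_
    rw [norm_mul, norm_pow, hω1, one_pow, one_mul, norm_sub_rev]
  rw [norm_mul, norm_one_sub_inv_of_norm_eq_one hω1] at hbound
  rw [le_inv_mul_iff₀ hpos]
  exact hbound


/-! ### Decay of twisted grid sums -/

/-- **First-order decay of a twisted grid sum**: for a `C¹` `2π`-periodic `g`, `n ∈ ℤ/Lℤ` nonzero at
torus distance `d` from `0` and `ω = e^{2πi n/L}`,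
`‖Σ_{j<L} ω^j g(2πj/L)‖ ≤ (L/(4d)) ∫₀^{2π} ‖g'‖`. [folklore] -/
theorem norm_sum_rootOfUnity_pow_mul_grid_le {g : ℝ → ℂ} (hg : ContDiff ℝ 1 g)
    (hper : Function.Periodic g (2 * π)) {L : ℕ} [NeZero L] (n : ZMod L) (hn : n ≠ 0) :
    ‖∑ j : Fin L, Complex.exp (2 * π * Complex.I * (n.val : ℕ) / L) ^ (j : ℕ) *
        g (2 * π * (j : ℕ) / L)‖ ≤
      (L : ℝ) / (4 * ((min n.val (-n).val : ℕ) : ℝ)) * ∫ x in (0 : ℝ)..(2 * π), ‖deriv g x‖ := by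
  obtain ⟨hωL, hω1⟩ := exp_two_pi_natCast_div_pow_eq_one (L := L) n.val
  have hdist := zmod_norm_one_sub_exp_ge n hn
  set ω := Complex.exp (2 * π * Complex.I * (n.val : ℕ) / L) with hω
  have hLpos : 0 < L := Nat.pos_of_ne_zero (NeZero.ne L)
  have hL : (0 : ℝ) < L := Nat.cast_pos.mpr hLpos
  set d : ℕ := min n.val (-n).val with hd
  have hd1 : 1 ≤ d := by
    have hv0 : 0 < n.val := Nat.pos_of_ne_zero ((ZMod.val_ne_zero n).mpr hn)
    have : 0 < (-n).val := Nat.pos_of_ne_zero ((ZMod.val_ne_zero (-n)).mpr (neg_ne_zero.mpr hn))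
    simp only [hd]; omega
  have hdpos : (0 : ℝ) < d := by exact_mod_cast hd1
  have hpos : 0 < ‖1 - ω‖ := lt_of_lt_of_le (by positivity) hdist
  have hne : ω ≠ 1 := fun h => by rw [h, sub_self, norm_zero] at hpos; exact lt_irrefl _ hpos
  have hsample := norm_sum_pow_mul_sample_le Real.two_pi_pos hg hper hLpos hωL hω1 hne 0
  have hgrid : ∀ j : ℕ, (0 : ℝ) + j * (2 * π / L) = 2 * π * (j : ℕ) / L := fun j => by ring
  simp_rw [hgrid] at hsample
  rw [Fin.sum_univ_eq_sum_range (fun j => ω ^ j * g (2 * π * (j : ℕ) / L)) L]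
  refine hsample.trans (mul_le_mul_of_nonneg_right ?_
    (intervalIntegral.integral_nonneg Real.two_pi_pos.le fun x _ => norm_nonneg _))
  rw [inv_le_comm₀ hpos (by positivity), inv_div]
  exact hdist

/-- `‖1 − ω‖⁻¹ ≤ L/(4d)` for `ω = e^{2πi n/L}`, `n ≠ 0` at torus distance `d` from `0`.
[folklore] -/
theorem inv_norm_one_sub_exp_le {L : ℕ} [NeZero L] (n : ZMod L) (hn : n ≠ 0) :
    ‖1 - Complex.exp (2 * π * Complex.I * (n.val : ℕ) / L)‖⁻¹ ≤
      (L : ℝ) / (4 * ((min n.val (-n).val : ℕ) : ℝ)) := by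
  have hL : (0 : ℝ) < L := Nat.cast_pos.mpr (Nat.pos_of_ne_zero (NeZero.ne L))
  have hdist := zmod_norm_one_sub_exp_ge n hn
  have hd1 : 1 ≤ min n.val (-n).val := by
    have hv0 : 0 < n.val := Nat.pos_of_ne_zero ((ZMod.val_ne_zero n).mpr hn)
    have : 0 < (-n).val := Nat.pos_of_ne_zero ((ZMod.val_ne_zero (-n)).mpr (neg_ne_zero.mpr hn))
    omega
  have hdpos : (0 : ℝ) < ((min n.val (-n).val : ℕ) : ℝ) := by exact_mod_cast hd1
  have hpos : 0 < ‖1 - Complex.exp (2 * π * Complex.I * (n.val : ℕ) / L)‖ :=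
    lt_of_lt_of_le (by positivity) hdist
  rw [inv_le_comm₀ hpos (by positivity), inv_div]
  exact hdist

/-- **Second-order decay of a twisted grid sum**: for a `C²` `2π`-periodic `g`, `n ∈ ℤ/Lℤ` nonzero
at torus distance `d` from `0` and `ω = e^{2πi n/L}`,
`‖Σ_{j<L} ω^j g(2πj/L)‖ ≤ (2π/L) (L/(4d))² ∫₀^{2π} ‖g''‖` (two summations by parts; the second one
inside the integral representing the first differences). [folklore] -/
theorem norm_sum_rootOfUnity_pow_mul_grid_le_two {g : ℝ → ℂ} (hg : ContDiff ℝ 2 g)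
    (hper : Function.Periodic g (2 * π)) {L : ℕ} [NeZero L] (n : ZMod L) (hn : n ≠ 0) :
    ‖∑ j : Fin L, Complex.exp (2 * π * Complex.I * (n.val : ℕ) / L) ^ (j : ℕ) *
        g (2 * π * (j : ℕ) / L)‖ ≤
      (2 * π / L) * ((L : ℝ) / (4 * ((min n.val (-n).val : ℕ) : ℝ))) ^ 2 *
        ∫ x in (0 : ℝ)..(2 * π), ‖iteratedDeriv 2 g x‖ := by
  obtain ⟨hωL, hω1⟩ := exp_two_pi_natCast_div_pow_eq_one (L := L) n.val
  have hinv := inv_norm_one_sub_exp_le n hn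
  have hdist := zmod_norm_one_sub_exp_ge n hn
  set ω := Complex.exp (2 * π * Complex.I * (n.val : ℕ) / L) with hω
  have hω0 : ω ≠ 0 := fun h => by simp [h] at hω1
  have hLpos : 0 < L := Nat.pos_of_ne_zero (NeZero.ne L)
  have hL : (0 : ℝ) < L := Nat.cast_pos.mpr hLpos
  set d : ℕ := min n.val (-n).val with hd
  have hd1 : 1 ≤ d := by
    have hv0 : 0 < n.val := Nat.pos_of_ne_zero ((ZMod.val_ne_zero n).mpr hn)
    have : 0 < (-n).val := Nat.pos_of_ne_zero ((ZMod.val_ne_zero (-n)).mpr (neg_ne_zero.mpr hn))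
    simp only [hd]; omega
  have hdpos : (0 : ℝ) < d := by exact_mod_cast hd1
  have hpos : 0 < ‖1 - ω‖ := lt_of_lt_of_le (by positivity) hdist
  have hne : ω ≠ 1 := fun h => by rw [h, sub_self, norm_zero] at hpos; exact lt_irrefl _ hpos
  -- regularity
  have hdg : ContDiff ℝ 1 (deriv g) := by
    have : ContDiff ℝ (1 + 1) g := by simpa [one_add_one_eq_two] using hg
    exact this.deriv'
  have hdper : Function.Periodic (deriv g) (2 * π) := periodic_deriv hper
  have hdiff : Differentiable ℝ g := hg.differentiable two_ne_zero
  have hcont : Continuous (deriv g) := hg.continuous_deriv (by norm_num)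
  have hdd : deriv (deriv g) = iteratedDeriv 2 g := by
    rw [iteratedDeriv_succ, iteratedDeriv_one]
  set K : ℝ := ‖1 - ω‖⁻¹ * ∫ x in (0 : ℝ)..(2 * π), ‖iteratedDeriv 2 g x‖ with hK
  -- the inner twisted sums of `g'` are uniformly bounded by `K`
  have hB : ∀ v : ℝ, ‖∑ j ∈ range L, ω ^ j * deriv g (v + j * (2 * π / L))‖ ≤ K := by
    intro v
    have := norm_sum_pow_mul_sample_le Real.two_pi_pos hdg hdper hLpos hωL hω1 hne v
    rwa [hdd] at this
  -- grid values and first differences as integrals of `g'`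
  set f : ℕ → ℂ := fun j => g (2 * π * (j : ℕ) / L) with hf
  have hfn : f L = f 0 := by
    simp only [hf, Nat.cast_zero, mul_zero, zero_div]
    rw [mul_div_assoc, div_self hL.ne', mul_one]
    simpa using hper 0
  have hstep : ∀ j : ℕ, f j - f (j + 1) =
      -∫ v in (0 : ℝ)..(2 * π / L), deriv g (v + j * (2 * π / L)) := by
    intro j
    rw [intervalIntegral.integral_comp_add_right (fun x => deriv g x) ((j : ℝ) * (2 * π / L)),
      intervalIntegral.integral_deriv_eq_sub (fun x _ => hdiff x) (hcont.intervalIntegrable _ _)]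
    have e1 : (0 : ℝ) + j * (2 * π / L) = 2 * π * (j : ℕ) / L := by ring
    have e2 : 2 * π / L + j * (2 * π / L) = 2 * π * ((j + 1 : ℕ) : ℝ) / L := by push_cast; ring
    rw [e1, e2, hf]
    ring
  have hsbp := one_sub_inv_mul_sum_pow_mul L hωL hω0 f hfn
  have hswap : ∑ j ∈ range L, ω ^ j * (f j - f (j + 1)) =
      -∫ v in (0 : ℝ)..(2 * π / L), ∑ j ∈ range L, ω ^ j * deriv g (v + j * (2 * π / L)) := by
    have hint : ∀ j ∈ range L, IntervalIntegrable
        (fun v => ω ^ j * deriv g (v + j * (2 * π / L))) volume (0 : ℝ) (2 * π / L) :=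
      fun j _ => (continuous_const.mul
        (hcont.comp (continuous_id.add continuous_const))).intervalIntegrable _ _
    rw [intervalIntegral.integral_finsetSum hint, ← Finset.sum_neg_distrib]
    refine sum_congr rfl fun j _ => ?_
    rw [hstep j, intervalIntegral.integral_const_mul, mul_neg]
  have hmain : ‖1 - ω‖ * ‖∑ j ∈ range L, ω ^ j * f j‖ ≤ K * (2 * π / L) := by
    rw [← norm_one_sub_inv_of_norm_eq_one hω1, ← norm_mul, hsbp, hswap, norm_neg]
    have := intervalIntegral.norm_integral_le_of_norm_le_const (a := (0 : ℝ)) (b := 2 * π / L)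
      (f := fun v => ∑ j ∈ range L, ω ^ j * deriv g (v + j * (2 * π / L))) (C := K)
      (fun v _ => hB v)
    simpa [sub_zero, abs_of_pos (by positivity : (0 : ℝ) < 2 * π / L)] using this
  rw [Fin.sum_univ_eq_sum_range (fun j => ω ^ j * g (2 * π * (j : ℕ) / L)) L]
  have hI : 0 ≤ ∫ x in (0 : ℝ)..(2 * π), ‖iteratedDeriv 2 g x‖ :=
    intervalIntegral.integral_nonneg Real.two_pi_pos.le fun x _ => norm_nonneg _
  have hK0 : 0 ≤ K := mul_nonneg (inv_nonneg.mpr (norm_nonneg _)) hI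
  calc ‖∑ j ∈ range L, ω ^ j * f j‖
      ≤ ‖1 - ω‖⁻¹ * (K * (2 * π / L)) := by
        rw [le_inv_mul_iff₀ hpos]; exact hmain
    _ = (2 * π / L) * (‖1 - ω‖⁻¹ * ‖1 - ω‖⁻¹) *
          ∫ x in (0 : ℝ)..(2 * π), ‖iteratedDeriv 2 g x‖ := by rw [hK]; ring
    _ ≤ (2 * π / L) * ((L : ℝ) / (4 * d)) ^ 2 * ∫ x in (0 : ℝ)..(2 * π), ‖iteratedDeriv 2 g x‖ := by
        refine mul_le_mul_of_nonneg_right (mul_le_mul_of_nonneg_left ?_ (by positivity)) hI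
        rw [sq]
        exact mul_le_mul hinv hinv (inv_nonneg.mpr (norm_nonneg _)) (by positivity)

/-- **Decay of a twisted double grid sum in one direction.**  For `F(s, r)` that is `C²` and
`2π`-periodic in `s`, `n ∈ ℤ/Lℤ` nonzero at torus distance `d` from `0`, and weights `‖c_j‖ ≤ 1`,
the normalised double grid sum `L⁻² Σ_{j₁ j₂} e^{2πi n j₁/L} c_{j₂} F(2πj₁/L, 2πj₂/L)` is bounded by
`Φ₁/(4d)` and by `(π/4) Φ₂/d²`, `Φ_m = L⁻¹ Σ_{j₂} ∫₀^{2π} ‖∂ₛ^m F(·, 2πj₂/L)‖` (used for the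
decay of translation-invariant torus resolvents across a cut). [folklore] -/
theorem norm_twisted_double_grid_sum_le {L : ℕ} [NeZero L] (n : ZMod L) (hn : n ≠ 0)
    (c : Fin L → ℂ) (hc : ∀ j, ‖c j‖ ≤ 1) (F : ℝ → ℝ → ℂ)
    (hF : ∀ r, ContDiff ℝ 2 (fun s => F s r))
    (hperF : ∀ r, Function.Periodic (fun s => F s r) (2 * π)) :
    ‖(1 / (L : ℂ) ^ 2) * ∑ j₁ : Fin L, ∑ j₂ : Fin L,
        Complex.exp (2 * π * Complex.I * (n.val : ℕ) / L) ^ (j₁ : ℕ) * c j₂ *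
          F (2 * π * (j₁ : ℕ) / L) (2 * π * (j₂ : ℕ) / L)‖ ≤
      (1 / (L : ℝ)) * (∑ j₂ : Fin L, ∫ x in (0 : ℝ)..(2 * π),
        ‖deriv (fun s => F s (2 * π * (j₂ : ℕ) / L)) x‖) / (4 * ((min n.val (-n).val : ℕ) : ℝ)) ∧
    ‖(1 / (L : ℂ) ^ 2) * ∑ j₁ : Fin L, ∑ j₂ : Fin L,
        Complex.exp (2 * π * Complex.I * (n.val : ℕ) / L) ^ (j₁ : ℕ) * c j₂ *
          F (2 * π * (j₁ : ℕ) / L) (2 * π * (j₂ : ℕ) / L)‖ ≤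
      π / 4 * ((1 / (L : ℝ)) * ∑ j₂ : Fin L, ∫ x in (0 : ℝ)..(2 * π),
        ‖iteratedDeriv 2 (fun s => F s (2 * π * (j₂ : ℕ) / L)) x‖) /
          ((min n.val (-n).val : ℕ) : ℝ) ^ 2 := by
  set ω := Complex.exp (2 * π * Complex.I * (n.val : ℕ) / L) with hω
  have hLpos : 0 < L := Nat.pos_of_ne_zero (NeZero.ne L)
  have hL : (0 : ℝ) < L := Nat.cast_pos.mpr hLpos
  set d : ℕ := min n.val (-n).val with hd
  have hd1 : 1 ≤ d := by
    have hv0 : 0 < n.val := Nat.pos_of_ne_zero ((ZMod.val_ne_zero n).mpr hn)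
    have : 0 < (-n).val := Nat.pos_of_ne_zero ((ZMod.val_ne_zero (-n)).mpr (neg_ne_zero.mpr hn))
    simp only [hd]; omega
  have hdpos : (0 : ℝ) < d := by exact_mod_cast hd1
  set r : Fin L → ℝ := fun j₂ => 2 * π * (j₂ : ℕ) / L with hr
  set A : Fin L → ℂ := fun j₂ => ∑ j₁ : Fin L, ω ^ (j₁ : ℕ) * F (2 * π * (j₁ : ℕ) / L) (r j₂)
    with hA
  have hswap : ∑ j₁ : Fin L, ∑ j₂ : Fin L, ω ^ (j₁ : ℕ) * c j₂ *
      F (2 * π * (j₁ : ℕ) / L) (2 * π * (j₂ : ℕ) / L) = ∑ j₂ : Fin L, c j₂ * A j₂ := by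
    rw [Finset.sum_comm]
    refine sum_congr rfl fun j₂ _ => ?_
    rw [hA, Finset.mul_sum]
    exact sum_congr rfl fun j₁ _ => by ring
  have hnormL : ‖(1 / (L : ℂ) ^ 2)‖ = 1 / (L : ℝ) ^ 2 := by simp
  have hI1 : ∀ j₂, 0 ≤ ∫ x in (0 : ℝ)..(2 * π), ‖deriv (fun s => F s (r j₂)) x‖ := fun j₂ =>
    intervalIntegral.integral_nonneg Real.two_pi_pos.le fun x _ => norm_nonneg _
  have hI2 : ∀ j₂, 0 ≤ ∫ x in (0 : ℝ)..(2 * π), ‖iteratedDeriv 2 (fun s => F s (r j₂)) x‖ :=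
    fun j₂ => intervalIntegral.integral_nonneg Real.two_pi_pos.le fun x _ => norm_nonneg _
  have hA1 : ∀ j₂, ‖c j₂ * A j₂‖ ≤
      (L : ℝ) / (4 * d) * ∫ x in (0 : ℝ)..(2 * π), ‖deriv (fun s => F s (r j₂)) x‖ := fun j₂ => by
    rw [norm_mul]
    refine (mul_le_mul (hc j₂) le_rfl (norm_nonneg _) zero_le_one).trans ?_
    rw [one_mul]
    exact norm_sum_rootOfUnity_pow_mul_grid_le ((hF (r j₂)).of_le (by norm_num)) (hperF (r j₂)) n hn
  have hA2 : ∀ j₂, ‖c j₂ * A j₂‖ ≤ (2 * π / L) * ((L : ℝ) / (4 * d)) ^ 2 *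
      ∫ x in (0 : ℝ)..(2 * π), ‖iteratedDeriv 2 (fun s => F s (r j₂)) x‖ := fun j₂ => by
    rw [norm_mul]
    refine (mul_le_mul (hc j₂) le_rfl (norm_nonneg _) zero_le_one).trans ?_
    rw [one_mul]
    exact norm_sum_rootOfUnity_pow_mul_grid_le_two (hF (r j₂)) (hperF (r j₂)) n hn
  rw [hswap, norm_mul, hnormL]
  constructor
  · calc 1 / (L : ℝ) ^ 2 * ‖∑ j₂ : Fin L, c j₂ * A j₂‖
        ≤ 1 / (L : ℝ) ^ 2 * ∑ j₂ : Fin L,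
            ((L : ℝ) / (4 * d) * ∫ x in (0 : ℝ)..(2 * π), ‖deriv (fun s => F s (r j₂)) x‖) :=
          mul_le_mul_of_nonneg_left ((norm_sum_le _ _).trans (sum_le_sum fun j₂ _ => hA1 j₂))
            (by positivity)
      _ = (1 / (L : ℝ)) * (∑ j₂ : Fin L, ∫ x in (0 : ℝ)..(2 * π),
            ‖deriv (fun s => F s (r j₂)) x‖) / (4 * d) := by
          rw [← Finset.mul_sum]
          field_simp
  · calc 1 / (L : ℝ) ^ 2 * ‖∑ j₂ : Fin L, c j₂ * A j₂‖
        ≤ 1 / (L : ℝ) ^ 2 * ∑ j₂ : Fin L, ((2 * π / L) * ((L : ℝ) / (4 * d)) ^ 2 *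
            ∫ x in (0 : ℝ)..(2 * π), ‖iteratedDeriv 2 (fun s => F s (r j₂)) x‖) :=
          mul_le_mul_of_nonneg_left ((norm_sum_le _ _).trans (sum_le_sum fun j₂ _ => hA2 j₂))
            (by positivity)
      _ = π / 8 * ((1 / (L : ℝ)) * ∑ j₂ : Fin L, ∫ x in (0 : ℝ)..(2 * π),
            ‖iteratedDeriv 2 (fun s => F s (r j₂)) x‖) / (d : ℝ) ^ 2 := by
          rw [← Finset.mul_sum]
          field_simp
          ring
      _ ≤ π / 4 * ((1 / (L : ℝ)) * ∑ j₂ : Fin L, ∫ x in (0 : ℝ)..(2 * π),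
            ‖iteratedDeriv 2 (fun s => F s (r j₂)) x‖) / (d : ℝ) ^ 2 := by
          have h0 : 0 ≤ (1 / (L : ℝ)) * ∑ j₂ : Fin L, ∫ x in (0 : ℝ)..(2 * π),
              ‖iteratedDeriv 2 (fun s => F s (r j₂)) x‖ :=
            mul_nonneg (by positivity) (sum_nonneg fun j₂ _ => hI2 j₂)
          refine div_le_div_of_nonneg_right ?_ (by positivity)
          nlinarith [Real.pi_pos, h0]

end Literature.MathematicalPhysics.QuantumLattice

end
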